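import Summits.AtomisticToContinuum.Crystallization.Theorems.PhononSlackCertificatesPeriodicGivenLayeredConvexity2
import Summits.AtomisticToContinuum.Crystallization.Theorems.PhononSlackCertificatesPeriodicGivenLayeredConvexity3

/-!
# Vertical pinning, part 2: calculus of the Lennard-Jones layer terms along a height shift

Helper for the registered stub `stub_verticalPinning` (T4b-iv) of line `Sketch` of the crux
`GappedShellCensus.CleanLimitsHaveWindows` (stmt-AtomisticToContinuum-15932).

For an exactly layered set of in-plane spacing `b` the interaction of a site with a layer at height `H` and
lateral offset `δ` is the lattice sum `Φ_δ(H) = Σ_{(i,j)} T(b²P_δ(i,j) + H²)`, `T(q) = q⁻⁶/12 − q⁻³/6`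
(`LayeredHull.cvx_layerInteraction_eq`). In the scaled variable `u = P + (H/b)²` one has
`T = (b⁻⁶/6)·e_β(u)`, `e_β(u) = (β/2)u⁻⁶ − u⁻³`, `β = b⁻⁶`, with `e_β' = g_β`, `g_β(u) = 3(u⁻⁴ − βu⁻⁷)`.
The function `g_β` is quasi-concave (`g_β' = 3u⁻⁸(7β − 4u³)`), so its minimum over an interval sits at an
end point (`vp_G_min_le`) and its maximum is located by the decidable three-case rule `vpM` (`vp_G_le_M`).
This gives certified per-site bounds, uniform in the height over an interval and in `β` over an interval,
for the change of the layer term when the height is shrunk (`vp_site_shrink`) or expanded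
(`vp_site_expand`, `vp_site_expand_crude`) by `τ b`; beyond the potential minimum the term increases with the
height (`vp_term_mono`). The layer sums (box `[-4,4]²` site by site, outside of the box dropped or bounded by
the square-shell tail of `LayeredHull.cvx_lattice_tsum_le`) and the `norm_num` certificates are in parts 3, 4.
[folklore]
-/

noncomputable section

namespace Summit.AtomisticToContinuum.Crystallization.Theorems.CleanHull

open scoped BigOperators
open Finset Literature.MathematicalPhysics.StatisticalMechanics

/-! ## The scaled layer term and its derivative -/

/-- The scaled derivative density `g_β(u) = 3(u⁻⁴ − β u⁻⁷)` (`= d e_β / du`). [folklore] -/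
def vpG (β u : ℝ) : ℝ := 3 * ((u⁻¹) ^ 4 - β * (u⁻¹) ^ 7)

/-- The scaled layer term `e_β(u) = (β/2) u⁻⁶ − u⁻³`. [folklore] -/
def vpE (β u : ℝ) : ℝ := β / 2 * (u⁻¹) ^ 6 - (u⁻¹) ^ 3

/-- The unscaled Lennard-Jones layer term `T(b²P + H²)`, `T(q) = q⁻⁶/12 − q⁻³/6`. [folklore] -/
def vpTerm (b P H : ℝ) : ℝ := 1 / 12 * ((b ^ 2 * P + H ^ 2)⁻¹) ^ 6 - 1 / 6 * ((b ^ 2 * P + H ^ 2)⁻¹) ^ 3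

/-- The normalised in-plane form `P_δ(i,j) = (i + j/2 + δ/2)² + (3/4)(j + δ/3)²`. [folklore] -/
def vpP (δ : ℤ) (p : ℤ × ℤ) : ℝ := ((p.1 : ℝ) + p.2 / 2 + δ / 2) ^ 2 + 3 / 4 * ((p.2 : ℝ) + δ / 3) ^ 2

/-- `P_δ ≥ 0`. [folklore] -/
theorem vpP_nonneg (δ : ℤ) (p : ℤ × ℤ) : 0 ≤ vpP δ p := by
  unfold vpP; positivity

/-- **Scaling**: `T(b²P + (yb)²) = (b⁻⁶/6) e_{b⁻⁶}(P + y²)`. [folklore] -/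
theorem vp_term_scale (b P y : ℝ) (hb : b ≠ 0) (hu : P + y ^ 2 ≠ 0) :
    vpTerm b P (y * b) = (b⁻¹) ^ 6 / 6 * vpE ((b⁻¹) ^ 6) (P + y ^ 2) := by
  unfold vpTerm vpE
  have e : b ^ 2 * P + (y * b) ^ 2 = b ^ 2 * (P + y ^ 2) := by ring
  rw [e, mul_inv, mul_pow, mul_pow, inv_pow, inv_pow]
  field_simp
  ring

/-- `e_β' = g_β`. [folklore] -/
theorem vp_hasDerivAt_E (β u : ℝ) (hu : u ≠ 0) : HasDerivAt (vpE β) (vpG β u) u := by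
  have hinv : HasDerivAt (fun u : ℝ => u⁻¹) (-(u ^ 2)⁻¹) u := hasDerivAt_inv hu
  have h := ((hinv.fun_pow 6).const_mul (β / 2)).sub (hinv.fun_pow 3)
  refine (h.congr_of_eventuallyEq ?_).congr_deriv ?_
  · exact Filter.Eventually.of_forall fun v => by simp [vpE]
  · simp only [Nat.cast_ofNat, show (6 - 1 : ℕ) = 5 from rfl, show (3 - 1 : ℕ) = 2 from rfl, vpG, inv_pow]
    field_simp
    ring

/-- `g_β'(u) = −12u⁻⁵ + 21βu⁻⁸`. [folklore] -/
theorem vp_hasDerivAt_G (β u : ℝ) (hu : u ≠ 0) :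
    HasDerivAt (vpG β) (-12 * (u⁻¹) ^ 5 + 21 * β * (u⁻¹) ^ 8) u := by
  have hinv : HasDerivAt (fun u : ℝ => u⁻¹) (-(u ^ 2)⁻¹) u := hasDerivAt_inv hu
  have h := ((hinv.fun_pow 4).sub ((hinv.fun_pow 7).const_mul β)).const_mul 3
  refine (h.congr_of_eventuallyEq ?_).congr_deriv ?_
  · exact Filter.Eventually.of_forall fun v => by simp [vpG]
  · simp only [Nat.cast_ofNat, show (4 - 1 : ℕ) = 3 from rfl, show (7 - 1 : ℕ) = 6 from rfl, inv_pow]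
    field_simp
    ring

/-- Sign of `g_β'`: nonnegative where `4u³ ≤ 7β`. [folklore] -/
theorem vp_derivG_nonneg {β u : ℝ} (hu : 0 < u) (h : 4 * u ^ 3 ≤ 7 * β) :
    0 ≤ -12 * (u⁻¹) ^ 5 + 21 * β * (u⁻¹) ^ 8 := by
  have e : -12 * (u⁻¹) ^ 5 + 21 * β * (u⁻¹) ^ 8 = 3 * (u⁻¹) ^ 8 * (7 * β - 4 * u ^ 3) := by
    field_simp; ring
  rw [e]
  have : 0 ≤ (u⁻¹) ^ 8 := by positivity
  have : 0 ≤ 7 * β - 4 * u ^ 3 := by linarith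
  positivity

/-- Sign of `g_β'`: nonpositive where `7β ≤ 4u³`. [folklore] -/
theorem vp_derivG_nonpos {β u : ℝ} (hu : 0 < u) (h : 7 * β ≤ 4 * u ^ 3) :
    -12 * (u⁻¹) ^ 5 + 21 * β * (u⁻¹) ^ 8 ≤ 0 := by
  have e : -12 * (u⁻¹) ^ 5 + 21 * β * (u⁻¹) ^ 8 = -(3 * (u⁻¹) ^ 8 * (4 * u ^ 3 - 7 * β)) := by
    field_simp; ring
  rw [e, neg_nonpos]
  have : 0 ≤ (u⁻¹) ^ 8 := by positivity
  have : 0 ≤ 4 * u ^ 3 - 7 * β := by linarith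
  positivity

/-- `g_β` is monotone on an interval `[p, r]`, `p > 0`, with `4r³ ≤ 7β`. [folklore] -/
theorem vp_G_monotoneOn {β p r : ℝ} (hp : 0 < p) (h : 4 * r ^ 3 ≤ 7 * β) :
    MonotoneOn (vpG β) (Set.Icc p r) := by
  refine monotoneOn_of_hasDerivWithinAt_nonneg (convex_Icc p r)
    (f' := fun u => -12 * (u⁻¹) ^ 5 + 21 * β * (u⁻¹) ^ 8) ?_ ?_ ?_
  · intro u hu
    exact (vp_hasDerivAt_G β u (by linarith [hu.1])).continuousAt.continuousWithinAt
  · intro u hu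
    exact (vp_hasDerivAt_G β u (by have := interior_subset hu; linarith [this.1])).hasDerivWithinAt
  · intro u hu
    have hu' := interior_subset hu
    have hu0 : 0 < u := by linarith [hu'.1]
    refine vp_derivG_nonneg hu0 (le_trans ?_ h)
    have : u ^ 3 ≤ r ^ 3 := pow_le_pow_left₀ hu0.le hu'.2 3
    linarith

/-- `g_β` is antitone on an interval `[p, r]`, `p > 0`, with `7β ≤ 4p³`. [folklore] -/
theorem vp_G_antitoneOn {β p r : ℝ} (hp : 0 < p) (h : 7 * β ≤ 4 * p ^ 3) :
    AntitoneOn (vpG β) (Set.Icc p r) := by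
  refine antitoneOn_of_hasDerivWithinAt_nonpos (convex_Icc p r)
    (f' := fun u => -12 * (u⁻¹) ^ 5 + 21 * β * (u⁻¹) ^ 8) ?_ ?_ ?_
  · intro u hu
    exact (vp_hasDerivAt_G β u (by linarith [hu.1])).continuousAt.continuousWithinAt
  · intro u hu
    exact (vp_hasDerivAt_G β u (by have := interior_subset hu; linarith [this.1])).hasDerivWithinAt
  · intro u hu
    have hu' := interior_subset hu
    have hu0 : 0 < u := by linarith [hu'.1]
    refine vp_derivG_nonpos hu0 (le_trans h ?_)
    have : p ^ 3 ≤ u ^ 3 := pow_le_pow_left₀ hp.le hu'.1 3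
    linarith

/-- **Quasi-concavity of `g_β`**: on `[U₁, U₂] ⊂ (0, ∞)` the minimum of `g_β` is at an end point.
[folklore] -/
theorem vp_G_min_le (β U₁ U₂ u : ℝ) (h0 : 0 < U₁) (hu : u ∈ Set.Icc U₁ U₂) :
    min (vpG β U₁) (vpG β U₂) ≤ vpG β u := by
  have hu0 : 0 < u := by linarith [hu.1]
  by_cases h : 4 * u ^ 3 ≤ 7 * β
  · have hmono := vp_G_monotoneOn (β := β) h0 h
    exact (min_le_left _ _).trans (hmono ⟨le_rfl, hu.1⟩ ⟨hu.1, le_rfl⟩ hu.1)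
  · have hanti := vp_G_antitoneOn (β := β) (r := U₂) hu0 (by linarith)
    exact (min_le_right _ _).trans (hanti ⟨le_rfl, hu.2⟩ ⟨hu.2, le_rfl⟩ hu.2)

/-- The decidable three-case majorant of `g_β` on `[U₁, U₂]`: `g_β(U₂)` if `g_β` increases there,
`g_β(U₁)` if it decreases, the decorrelated `3(U₁⁻⁴ − βU₂⁻⁷)` otherwise. [folklore] -/
def vpM (β U₁ U₂ : ℝ) : ℝ :=
  if 4 * U₂ ^ 3 ≤ 7 * β then vpG β U₂
  else if 7 * β ≤ 4 * U₁ ^ 3 then vpG β U₁ else 3 * ((U₁⁻¹) ^ 4 - β * (U₂⁻¹) ^ 7)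

/-- **The majorant**: `g_β ≤ vpM β U₁ U₂` on `[U₁, U₂]` (`β ≥ 0`, `U₁ > 0`). [folklore] -/
theorem vp_G_le_M (β U₁ U₂ u : ℝ) (hβ : 0 ≤ β) (h0 : 0 < U₁) (hu : u ∈ Set.Icc U₁ U₂) :
    vpG β u ≤ vpM β U₁ U₂ := by
  have hu0 : 0 < u := by linarith [hu.1]
  unfold vpM
  split_ifs with h1 h2
  · exact vp_G_monotoneOn (β := β) h0 h1 ⟨hu.1, hu.2⟩ ⟨by linarith [hu.1, hu.2], le_rfl⟩ hu.2
  · exact vp_G_antitoneOn (β := β) (r := U₂) h0 h2 ⟨le_rfl, by linarith [hu.1, hu.2]⟩ ⟨hu.1, hu.2⟩ hu.1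
  · unfold vpG
    have hU₂ : 0 < U₂ := by linarith [hu.1, hu.2]
    have h4 : (u⁻¹) ^ 4 ≤ (U₁⁻¹) ^ 4 :=
      pow_le_pow_left₀ (by positivity) (inv_anti₀ h0 hu.1) 4
    have h7 : (U₂⁻¹) ^ 7 ≤ (u⁻¹) ^ 7 :=
      pow_le_pow_left₀ (by positivity) (inv_anti₀ hu0 hu.2) 7
    nlinarith [mul_le_mul_of_nonneg_left h7 hβ]

/-! ## Differences of the scaled layer term -/

/-- `e_β(u₂) − e_β(u₁) ≥ (u₂ − u₁)·m` if `m ≤ g_β` on `[u₁, u₂]`. [folklore] -/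
theorem vp_E_diff_ge {β u₁ u₂ m : ℝ} (h0 : 0 < u₁) (h12 : u₁ ≤ u₂)
    (hm : ∀ u ∈ Set.Icc u₁ u₂, m ≤ vpG β u) : (u₂ - u₁) * m ≤ vpE β u₂ - vpE β u₁ := by
  have hmono : MonotoneOn (fun u => vpE β u - m * u) (Set.Icc u₁ u₂) := by
    refine monotoneOn_of_hasDerivWithinAt_nonneg (convex_Icc u₁ u₂) (f' := fun u => vpG β u - m)
      ?_ ?_ ?_
    · intro u hu
      exact ((vp_hasDerivAt_E β u (by linarith [hu.1])).sub
        ((hasDerivAt_id u).const_mul m)).continuousAt.continuousWithinAt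
    · intro u hu
      have hu' := interior_subset hu
      exact (((vp_hasDerivAt_E β u (by linarith [hu'.1])).sub
        ((hasDerivAt_id u).const_mul m)).congr_deriv (by simp)).hasDerivWithinAt
    · intro u hu
      have := hm u (interior_subset hu)
      linarith
  have := hmono ⟨le_rfl, h12⟩ ⟨h12, le_rfl⟩ h12
  simp only at this
  linarith

/-- `e_β(u₂) − e_β(u₁) ≤ (u₂ − u₁)·M` if `g_β ≤ M` on `[u₁, u₂]`. [folklore] -/
theorem vp_E_diff_le {β u₁ u₂ M : ℝ} (h0 : 0 < u₁) (h12 : u₁ ≤ u₂)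
    (hM : ∀ u ∈ Set.Icc u₁ u₂, vpG β u ≤ M) : vpE β u₂ - vpE β u₁ ≤ (u₂ - u₁) * M := by
  have hanti : AntitoneOn (fun u => vpE β u - M * u) (Set.Icc u₁ u₂) := by
    refine antitoneOn_of_hasDerivWithinAt_nonpos (convex_Icc u₁ u₂) (f' := fun u => vpG β u - M)
      ?_ ?_ ?_
    · intro u hu
      exact ((vp_hasDerivAt_E β u (by linarith [hu.1])).sub
        ((hasDerivAt_id u).const_mul M)).continuousAt.continuousWithinAt
    · intro u hu
      have hu' := interior_subset hu
      exact (((vp_hasDerivAt_E β u (by linarith [hu'.1])).sub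
        ((hasDerivAt_id u).const_mul M)).congr_deriv (by simp)).hasDerivWithinAt
    · intro u hu
      have := hM u (interior_subset hu)
      linarith
  have := hanti ⟨le_rfl, h12⟩ ⟨h12, le_rfl⟩ h12
  simp only at this
  linarith

/-- Monotonicity in `β`: the difference `e_β(u₂) − e_β(u₁)` (`u₁ ≤ u₂`) decreases with `β`. [folklore] -/
theorem vp_E_diff_mono_beta {β₀ β u₁ u₂ : ℝ} (h0 : 0 < u₁) (h12 : u₁ ≤ u₂) (hβ : β₀ ≤ β) :
    vpE β u₂ - vpE β u₁ ≤ vpE β₀ u₂ - vpE β₀ u₁ := by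
  unfold vpE
  have hu₂ : 0 < u₂ := by linarith
  have h6 : (u₂⁻¹) ^ 6 ≤ (u₁⁻¹) ^ 6 := pow_le_pow_left₀ (by positivity) (inv_anti₀ h0 h12) 6
  nlinarith [mul_nonneg (sub_nonneg.2 hβ) (sub_nonneg.2 h6)]

/-! ## Per-site bounds -/

/-- The certified per-site coefficient for SHRINKING the height from `x b` to `(x − τ) b`, uniform in
`x ∈ [x₁, x₂]`: `min((2x₁−τ)m, (2x₂−τ)m)`, `m = min(g_β(P+(x₁−τ)²), g_β(P+x₂²))`. [folklore] -/
def vpCs (β P x₁ x₂ τ : ℝ) : ℝ :=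
  min ((2 * x₁ - τ) * min (vpG β (P + (x₁ - τ) ^ 2)) (vpG β (P + x₂ ^ 2)))
    ((2 * x₂ - τ) * min (vpG β (P + (x₁ - τ) ^ 2)) (vpG β (P + x₂ ^ 2)))

/-- The certified per-site coefficient for EXPANDING the height from `x b` to `(x + τ) b`, uniform in
`x ∈ [x₁, x₂]`: `min(−(2x₁+τ)M, −(2x₂+τ)M)`, `M = vpM β (P+x₁²) (P+(x₂+τ)²)`. [folklore] -/
def vpCe (β P x₁ x₂ τ : ℝ) : ℝ :=
  min (-(2 * x₁ + τ) * vpM β (P + x₁ ^ 2) (P + (x₂ + τ) ^ 2))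
    (-(2 * x₂ + τ) * vpM β (P + x₁ ^ 2) (P + (x₂ + τ) ^ 2))

/-- **Per-site bound, shrinking.** For `b > 0` with `b⁻⁶ ≤ β`, `P ≥ 0`, `0 < τ < x₁ ≤ x ≤ x₂`:
`(b⁻⁶/6)·τ·vpCs ≤ T(b²P + (xb)²) − T(b²P + ((x−τ)b)²)`. [folklore] -/
theorem vp_site_shrink (b β P x₁ x₂ τ x : ℝ) (hb : 0 < b) (hβ : (b⁻¹) ^ 6 ≤ β) (hP : 0 ≤ P)
    (hτ : 0 < τ) (hx₁ : τ < x₁) (h1 : x₁ ≤ x) (h2 : x ≤ x₂) :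
    (b⁻¹) ^ 6 / 6 * (τ * vpCs β P x₁ x₂ τ) ≤ vpTerm b P (x * b) - vpTerm b P ((x - τ) * b) := by
  have hxτ : 0 < x - τ := by linarith
  have hU₁ : 0 < P + (x₁ - τ) ^ 2 := add_pos_of_nonneg_of_pos hP (pow_pos (by linarith) 2)
  have hx0 : 0 < x := by linarith
  have hu₁ : P + (x₁ - τ) ^ 2 ≤ P + (x - τ) ^ 2 := by nlinarith
  have hu₁₂ : P + (x - τ) ^ 2 ≤ P + x ^ 2 := by nlinarith
  have hu₂ : P + x ^ 2 ≤ P + x₂ ^ 2 := by nlinarith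
  have hu₁0 : 0 < P + (x - τ) ^ 2 := by linarith
  rw [vp_term_scale b P x hb.ne' (by linarith), vp_term_scale b P (x - τ) hb.ne' (by linarith), ← mul_sub]
  refine mul_le_mul_of_nonneg_left ?_ (by positivity)
  set m := min (vpG β (P + (x₁ - τ) ^ 2)) (vpG β (P + x₂ ^ 2)) with hm_def
  have hm : ∀ u ∈ Set.Icc (P + (x - τ) ^ 2) (P + x ^ 2), m ≤ vpG β u := fun u hu =>
    vp_G_min_le β _ _ u hU₁ ⟨le_trans hu₁ hu.1, le_trans hu.2 hu₂⟩
  have hdiff := vp_E_diff_ge hu₁0 hu₁₂ hm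
  have hmonoβ := vp_E_diff_mono_beta (β₀ := (b⁻¹) ^ 6) (β := β) hu₁0 hu₁₂ hβ
  have hgap : P + x ^ 2 - (P + (x - τ) ^ 2) = τ * (2 * x - τ) := by ring
  rw [hgap] at hdiff
  have hC : τ * vpCs β P x₁ x₂ τ ≤ τ * (2 * x - τ) * m := by
    rw [mul_assoc]
    refine mul_le_mul_of_nonneg_left ?_ hτ.le
    unfold vpCs
    rw [← hm_def]
    rcases le_or_gt 0 m with hm0 | hm0
    · exact (min_le_left _ _).trans (mul_le_mul_of_nonneg_right (by linarith) hm0)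
    · exact (min_le_right _ _).trans (mul_le_mul_of_nonpos_right (by linarith) hm0.le)
  linarith

/-- **Per-site bound, expanding.** For `b > 0` with `0 ≤ β ≤ b⁻⁶`, `P ≥ 0`, `0 < τ`, `0 < x₁ ≤ x ≤ x₂`:
`(b⁻⁶/6)·τ·vpCe ≤ T(b²P + (xb)²) − T(b²P + ((x+τ)b)²)`. [folklore] -/
theorem vp_site_expand (b β P x₁ x₂ τ x : ℝ) (hb : 0 < b) (hβ0 : 0 ≤ β) (hβ : β ≤ (b⁻¹) ^ 6)
    (hP : 0 ≤ P) (hτ : 0 < τ) (hx₁ : 0 < x₁) (h1 : x₁ ≤ x) (h2 : x ≤ x₂) :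
    (b⁻¹) ^ 6 / 6 * (τ * vpCe β P x₁ x₂ τ) ≤ vpTerm b P (x * b) - vpTerm b P ((x + τ) * b) := by
  have hU₁ : 0 < P + x₁ ^ 2 := add_pos_of_nonneg_of_pos hP (pow_pos hx₁ 2)
  have hx0 : 0 < x := by linarith
  have hu₁ : P + x₁ ^ 2 ≤ P + x ^ 2 := by nlinarith
  have hu₁₂ : P + x ^ 2 ≤ P + (x + τ) ^ 2 := by nlinarith
  have hu₂ : P + (x + τ) ^ 2 ≤ P + (x₂ + τ) ^ 2 := by nlinarith
  have hu₁0 : 0 < P + x ^ 2 := by linarith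
  rw [vp_term_scale b P x hb.ne' (by linarith), vp_term_scale b P (x + τ) hb.ne' (by linarith), ← mul_sub]
  refine mul_le_mul_of_nonneg_left ?_ (by positivity)
  set M := vpM β (P + x₁ ^ 2) (P + (x₂ + τ) ^ 2) with hM_def
  have hM : ∀ u ∈ Set.Icc (P + x ^ 2) (P + (x + τ) ^ 2), vpG β u ≤ M := fun u hu =>
    vp_G_le_M β _ _ u hβ0 hU₁ ⟨le_trans hu₁ hu.1, le_trans hu.2 hu₂⟩
  have hdiff := vp_E_diff_le hu₁0 hu₁₂ hM
  have hmonoβ := vp_E_diff_mono_beta (β₀ := β) (β := (b⁻¹) ^ 6) hu₁0 hu₁₂ hβ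
  have hgap : P + (x + τ) ^ 2 - (P + x ^ 2) = τ * (2 * x + τ) := by ring
  rw [hgap] at hdiff
  have hC : τ * vpCe β P x₁ x₂ τ ≤ -(τ * (2 * x + τ) * M) := by
    rw [show -(τ * (2 * x + τ) * M) = τ * (-(2 * x + τ) * M) by ring]
    refine mul_le_mul_of_nonneg_left ?_ hτ.le
    unfold vpCe
    rw [← hM_def]
    rcases le_or_gt 0 M with hM0 | hM0
    · refine (min_le_right _ _).trans ?_
      nlinarith
    · refine (min_le_left _ _).trans ?_
      nlinarith
  linarith

/-- **Crude per-site bound, expanding** (for the tails): `g_β ≤ 3u⁻⁴`, hence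
`−(b⁻⁶/6)·τ(2x₂+τ)·3(P+x₁²)⁻⁴ ≤ T(b²P + (xb)²) − T(b²P + ((x+τ)b)²)`. [folklore] -/
theorem vp_site_expand_crude (b P x₁ x₂ τ x : ℝ) (hb : 0 < b) (hP : 0 ≤ P) (hτ : 0 < τ)
    (hx₁ : 0 < x₁) (h1 : x₁ ≤ x) (h2 : x ≤ x₂) :
    -((b⁻¹) ^ 6 / 6 * (τ * (2 * x₂ + τ) * (3 * ((P + x₁ ^ 2)⁻¹) ^ 4))) ≤
      vpTerm b P (x * b) - vpTerm b P ((x + τ) * b) := by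
  have hU₁ : 0 < P + x₁ ^ 2 := add_pos_of_nonneg_of_pos hP (pow_pos hx₁ 2)
  have hx0 : 0 < x := by linarith
  have hu₁ : P + x₁ ^ 2 ≤ P + x ^ 2 := by nlinarith
  have hu₁₂ : P + x ^ 2 ≤ P + (x + τ) ^ 2 := by nlinarith
  have hu₁0 : 0 < P + x ^ 2 := by linarith
  rw [vp_term_scale b P x hb.ne' (by linarith), vp_term_scale b P (x + τ) hb.ne' (by linarith), ← mul_sub,
    ← mul_neg]
  refine mul_le_mul_of_nonneg_left ?_ (by positivity)
  set M := 3 * ((P + x₁ ^ 2)⁻¹) ^ 4 with hM_def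
  have hM0 : 0 ≤ M := by positivity
  have hM : ∀ u ∈ Set.Icc (P + x ^ 2) (P + (x + τ) ^ 2), vpG ((b⁻¹) ^ 6) u ≤ M := by
    intro u hu
    have hu0 : 0 < u := by linarith [hu.1]
    unfold vpG
    have h4 : (u⁻¹) ^ 4 ≤ ((P + x₁ ^ 2)⁻¹) ^ 4 :=
      pow_le_pow_left₀ (by positivity) (inv_anti₀ hU₁ (le_trans hu₁ hu.1)) 4
    have h7 : 0 ≤ (b⁻¹) ^ 6 * (u⁻¹) ^ 7 := by positivity
    rw [hM_def]
    linarith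
  have hdiff := vp_E_diff_le hu₁0 hu₁₂ hM
  have hgap : P + (x + τ) ^ 2 - (P + x ^ 2) = τ * (2 * x + τ) := by ring
  rw [hgap] at hdiff
  have : τ * (2 * x + τ) * M ≤ τ * (2 * x₂ + τ) * M := by
    apply mul_le_mul_of_nonneg_right _ hM0
    exact mul_le_mul_of_nonneg_left (by linarith) hτ.le
  linarith

/-- **Monotonicity of the layer term beyond the potential minimum**: if `1 ≤ b²P + H'²` and
`0 ≤ H' ≤ H` then `T(b²P + H'²) ≤ T(b²P + H²)`. [folklore] -/
theorem vp_term_mono (b P H H' : ℝ) (hH' : 0 ≤ H') (hle : H' ≤ H) (h1 : 1 ≤ b ^ 2 * P + H' ^ 2) :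
    vpTerm b P H' ≤ vpTerm b P H := by
  unfold vpTerm
  set q₁ := b ^ 2 * P + H' ^ 2 with hq₁
  set q₂ := b ^ 2 * P + H ^ 2 with hq₂
  have hq12 : q₁ ≤ q₂ := by rw [hq₁, hq₂]; nlinarith
  have hq₁0 : 0 < q₁ := by linarith
  have hq₂0 : 0 < q₂ := by linarith
  have hA1 : (q₁⁻¹) ^ 3 ≤ 1 := pow_le_one₀ (by positivity) (inv_le_one_of_one_le₀ h1)
  have hBA : (q₂⁻¹) ^ 3 ≤ (q₁⁻¹) ^ 3 := pow_le_pow_left₀ (by positivity) (inv_anti₀ hq₁0 hq12) 3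
  have hB0 : 0 ≤ (q₂⁻¹) ^ 3 := by positivity
  have e1 : (q₁⁻¹) ^ 6 = ((q₁⁻¹) ^ 3) ^ 2 := by ring
  have e2 : (q₂⁻¹) ^ 6 = ((q₂⁻¹) ^ 3) ^ 2 := by ring
  rw [e1, e2]
  nlinarith [mul_nonneg (sub_nonneg.2 hBA) (show 0 ≤ 2 - (q₁⁻¹) ^ 3 - (q₂⁻¹) ^ 3 by linarith)]

end Summit.AtomisticToContinuum.Crystallization.Theorems.CleanHull

end
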